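import Literature.AlgebraicGeometry.Motives.CartierDivisorOfIdealSheaf
import Literature.AlgebraicGeometry.Motives.VarietiesRegularProofs
import Literature.AlgebraicGeometry.Motives.AbelianVarietyAmpleProofs
import Literature.AlgebraicGeometry.Resolution.DivisorialPart
import HarnessLib

/-!
# An effective Cartier divisor with irreducible support is a multiple of the prime divisor of its support

Layer `Literature/AlgebraicGeometry/Motives` (namespaces `….Motives.CartierDivisor`, `….Resolution`, `….Motives.AbelianVariety`).
KERNEL ONLY (theorems; no definition, no named fact, no instance, no `sorry`).  Glue between the tree's two currencies for
effective Cartier divisors — the tuples `(U_i, f_i)` of ★ `Motives/CartierDivisor` (`IsEffective`, `SameDivisor`, `n • D`,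
support `X ∖ X_1 = (D.nonvanishing 1)ᶜ`) and the invertible ideal sheaves of ★ `Resolution/Blowups` (`IsEffectiveCartier`) —
and the DIVISORIAL-PART machinery of ★ `Resolution/DivisorialPart` (Cossart–Piltant 2008, proof of Prop. 4.2:
`I = H · J`, `H = ∏ᵢ 𝓘_{E_i}^{ord_{E_i} I}` over the codimension-one points of `V(I)`, `V(J)` = the non-locally-principal locus).

## The mathematics (Hartshorne II.6.11 / Görtz–Wedhorn I Thm. 11.40 (2) for ONE prime divisor)

Let `X` be a REGULAR integral Noetherian scheme (e.g. an abelian variety over a field: smooth over a field ⇒ regular,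
★ `AbelianVariety.isRegularLocalRing_stalk`).  Regular local rings are factorial (Auslander–Buchsbaum, ★
`Resolution.Scheme.IsRegular.uniqueFactorizationMonoid_stalk`), so the ideal `𝓘_Z` of a closed irreducible subset `Z` of
codimension one is an effective Cartier divisor (★ `Resolution.isEffectiveCartier_primeDivisorIdeal_of_isRegular`).  Let `I` be an
invertible ideal sheaf (`IsEffectiveCartier I`) whose support `V(I)` is `Z = cl{η}`.  Since `I` is locally principal, its part of
codimension `≥ 2` is trivial (★ `isLocallyPrincipal_iff_codimTwoPart_eq_top`), so `I` equals its divisorial part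
`∏_{ζ} 𝓘_{cl ζ}^{a(ζ)}` over the codimension-one points `ζ` of `V(I) = cl{η}` (★ `divisorialPart_mul_codimTwoPart`); these all lie
below `η`, two distinct codimension-one points never specialise to one another (★ `not_specializes_of_coheight_eq_one`), and the set
is non-empty (else `I = 𝒪_X`, `V(I) = ∅`) — so `η` itself has codimension one, is the ONLY such point, and

  **`I = 𝓘_Z^a` with `a = ord_η I ≥ 1`** (§2, `IsEffectiveCartier.eq_primeDivisorIdeal_pow_of_support_eq_closure`).

Transporting through the bridges `D ↦ 𝒪_X(−D)` (★ `CartierDivisor.IsEffective.idealSheaf`) and `I ↦ (U_x, g_x)` (★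
`CartierDivisor.ofIsEffectiveCartier`), with the two bookkeeping identities `𝒪(−nD) = 𝒪(−D)^n` and «same ideal sheaf ⇒ same
divisor» (§1), gives the Cartier-divisor form (§3): an effective `D` with `X ∖ X_1 = cl{η}` is the SAME DIVISOR as `a • [Z]`,
`a ≥ 1`; and two effective divisors with the same irreducible support are `m₁ • [Z]`, `m₂ • [Z]` (§3–§4; for abelian varieties:
**`AbelianVariety.exists_sameDivisor_smul_of_support_eq`**, the letter (ii) of the (Θ-uniq) chain of the cell `hodgecm-mathlib`).

## What is proved
§1 `CartierDivisor.IsEffective.coe_support_idealSheaf` (`Supp 𝒪(−D) = X ∖ X_1`), `CartierDivisor.IsEffective.idealSheaf_smul`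
(`𝒪(−nD) = 𝒪(−D)^n`), `CartierDivisor.SameDivisor.of_idealSheaf_eq`; §2 `Resolution.IsEffectiveCartier.ne_bot_of_nonempty`,
**`Resolution.IsEffectiveCartier.eq_primeDivisorIdeal_pow_of_support_eq_closure`**; §3
**`CartierDivisor.IsEffective.exists_sameDivisor_smul_of_support_eq_closure`**, `CartierDivisor.exists_sameDivisor_smul_of_support_eq`
(two divisors, any regular integral Noetherian scheme); §4 **`AbelianVariety.exists_sameDivisor_smul_of_support_eq`**.
Use (cell `hodgecm-mathlib`, D-0151; crux HLiu418 = stmt-HodgeConjecture-24832, interface row VI-8, route G3 = the (Θ-uniq) chain,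
leaf (ii) = the `hmult` binder of the glue, socket letters of record `ThetaUniq.sockets` 159f929b32c9657a).  COUNT-NEUTRAL.  HC_CM is
proved only modulo the 7 printed citations until rung 0 closes; this file moves no book by itself.

## References
* [Hartshorne1977] R. Hartshorne, *Algebraic Geometry* (1977), II.6, Prop. 6.11 and Remark 6.11.2 (Weil = Cartier divisors on
  locally factorial schemes; pp. 141–142).
* [GortzWedhorn2020] U. Görtz, T. Wedhorn, *Algebraic Geometry I*, 2nd ed. (2020), Thm. 11.40 (2) (p. 386), Remark 11.27 and
  (11.12) (pp. 378–379).
* [CossartPiltant2008] V. Cossart, O. Piltant, *Resolution of singularities of threefolds in positive characteristic I*,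
  J. Algebra 320 (2008), proof of Prop. 4.2 (the divisorial part of an ideal).
* [Matsumura1987] H. Matsumura, *Commutative Ring Theory* (1987), Thm. 20.3 (Auslander–Buchsbaum).
* [Lange2023AbelianVarietiesComplex] H. Lange, *Abelian Varieties over the Complex Numbers* (2023), §4.2.1 Lemma 4.2.1 (ii),
  Cor. 4.2.4 (the use: `W̃_{g−1}` irreducible of codimension one, theta divisors with that support).
-/

set_option autoImplicit false

noncomputable section

open CategoryTheory AlgebraicGeometry TopologicalSpace Opposite

universe u

namespace Literature.AlgebraicGeometry.Motives

namespace CartierDivisor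

open RatFn Literature.AlgebraicGeometry.Resolution

variable {X : Scheme.{u}} [IsIntegral X] {D E : CartierDivisor X}

/-! ## §1 Bookkeeping between `(U_i, f_i)` and `𝒪_X(−D)` -/

/-- **`Supp 𝒪_X(−D) = X ∖ X_1`**: the support of the ideal sheaf of an effective Cartier divisor is the complement of the
non-vanishing locus of its canonical section `1` (★ `mem_support_idealSheaf_iff` with ★ `avoids_iff_mem_nonvanishing_one`).
[cite: GortzWedhorn2020, Remark 11.27 and (11.12) (pp. 378–379)] -/
theorem IsEffective.coe_support_idealSheaf (hD : D.IsEffective) :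
    (hD.idealSheaf.support : Set X) = (D.nonvanishing 1)ᶜ := by
  ext x
  change x ∈ hD.idealSheaf.support ↔ _
  rw [hD.mem_support_idealSheaf_iff, Set.mem_compl_iff, avoids_iff_mem_nonvanishing_one]

/-- **`𝒪_X(−nD) = 𝒪_X(−D)^n`**: the ideal sheaf of `n • D` (local equations `f_i^n`, ★ `smul_f`) is the `n`-th power of the
ideal sheaf of `D` — checked on the affine opens `W ⊆ U_i` on which `f_i` is a section `t`, where both are `(t^n)` (★
`sectionIdeal_eq_span`); such `W` cover `X` (★ `IsEffective.exists_affine_secFn_eq`). [cite: GortzWedhorn2020, Remark 11.27 and (11.12) (pp. 378–379)] -/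
theorem IsEffective.idealSheaf_smul (hD : D.IsEffective) (n : ℕ) :
    (hD.smul n).idealSheaf = hD.idealSheaf ^ n := by
  -- index the small affine charts by (point, chart index, affine open, section) packages
  refine Scheme.IdealSheafData.ext_of_iSup_eq_top
    (fun p : {p : (Σ i : D.ι, X.affineOpens × Γ(X, (⊤ : X.Opens))) × X //
        ∃ (hx : p.2 ∈ (p.1.2.1 : X.Opens)), (p.1.2.1 : X.Opens) ≤ D.U p.1.1 ∧
          ∃ t : Γ(X, p.1.2.1), secFn hx t = D.f p.1.1} => p.1.1.2.1) ?_ ?_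
  · refine top_le_iff.mp fun y _ => ?_
    obtain ⟨i, hyi⟩ := D.covers y
    obtain ⟨W, hyW, hWi, -, t, ht⟩ := hD.exists_affine_secFn_eq hyi (O := ⊤) trivial
    exact Opens.mem_iSup.mpr ⟨⟨(⟨i, W, 0⟩, y), hyW, hWi, t, ht⟩, hyW⟩
  · rintro ⟨⟨⟨i, W, _⟩, y⟩, hyW, hWi, t, ht⟩
    change (n • D).sectionIdeal W = (hD.idealSheaf ^ n).ideal W
    rw [Scheme.IdealSheafData.ideal_pow, Pi.pow_apply, IsEffective.ideal_idealSheaf, sectionIdeal_eq_span hyW hWi ht,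
      Ideal.span_singleton_pow]
    have ht' : secFn hyW (t ^ n) = (n • D).f i := by rw [secFn_pow, ht]; rfl
    exact sectionIdeal_eq_span (D := n • D) (i := i) hyW hWi ht'

/-- **Same ideal sheaf ⇒ same divisor**: two effective Cartier divisors `D = (U_i, f_i)`, `E = (V_j, g_j)` with
`𝒪_X(−D) = 𝒪_X(−E)` define the same divisor (`f_i / g_j ∈ 𝒪_{X,x}^×` on `U_i ∩ V_j`): near `x`, on a common affine `W`, `f_{i′}` and
`g_{j′}` are sections `t`, `t′` with `𝒪(−D)(W) = (t)`, `𝒪(−E)(W) = (t′)` (★ `IsEffective.exists_ideal_sup_eq_span`), so `(t) = (t′)` and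
`t / t′` is a unit (★ `isUnitAt_secFn_div_of_span_eq`); the cocycle conditions of `D` and `E` move the indices.  Görtz–Wedhorn I,
Remark 11.27: effective Cartier divisors ↔ invertible ideal sheaves. [cite: GortzWedhorn2020, Remark 11.27 and (11.12) (pp. 378–379)] -/
theorem SameDivisor.of_idealSheaf_eq (hD : D.IsEffective) (hE : E.IsEffective) (h : hD.idealSheaf = hE.idealSheaf) :
    D.SameDivisor E := by
  intro i j x hi hj
  obtain ⟨W, hxW, i', j', t, t', hWi', hWj', ht, ht', hI, hI', -⟩ := hD.exists_ideal_sup_eq_span hE x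
  have ht'0 : t' ≠ 0 := fun h0 => E.f_ne_zero j' (by rw [← ht', h0, secFn_zero])
  have hspan : Ideal.span {t} = Ideal.span {t'} := by rw [← hI, ← hI', h]
  have hmid : IsUnitAt x (D.f i' / E.f j') := by
    rw [← ht, ← ht']
    exact isUnitAt_secFn_div_of_span_eq hxW hxW ht'0 hspan
  have h3 := ((D.isUnitAt_div i i' x hi (hWi' hxW)).mul hmid).mul (E.isUnitAt_div j' j x (hWj' hxW) hj)
  rwa [div_mul_div_cancel₀ (D.f_ne_zero i'), div_mul_div_cancel₀ (E.f_ne_zero j')] at h3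

end CartierDivisor

end Literature.AlgebraicGeometry.Motives

namespace Literature.AlgebraicGeometry.Resolution

open Scheme.IdealSheafData IsLocalRing

variable {X : Scheme.{u}}

/-! ## §2 Invertible ideal sheaves with irreducible support on a regular scheme -/

/-- An effective Cartier ideal sheaf on a non-empty scheme is not the zero ideal sheaf (it is generated near any point by a
regular element of a non-trivial ring). [cite: GortzWedhorn2020, (13.19) p. 413 with Remark 11.27] -/
theorem IsEffectiveCartier.ne_bot_of_nonempty [Nonempty X] {I : X.IdealSheafData} (hI : IsEffectiveCartier I) : I ≠ ⊥ := by
  intro h0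
  obtain ⟨U, hxU, g, hg, hU⟩ := hI (Classical.arbitrary X)
  rw [h0, Scheme.IdealSheafData.ideal_bot, Pi.bot_apply, eq_comm, Ideal.span_singleton_eq_bot] at hU
  subst hU
  haveI : Nonempty (U : X.Opens) := ⟨⟨_, hxU⟩⟩
  exact zero_notMem_nonZeroDivisors hg

/-- **An invertible ideal sheaf with irreducible support on a regular integral Noetherian scheme is a power of a prime divisor
ideal**: if `IsEffectiveCartier I` and `V(I) = cl{η}`, then `η` has codimension one, `a := ord_η I ≥ 1`, and `I = 𝓘_{cl η}^a`.
Proof as in the module docstring: `I` locally principal ⇒ `I` is its divisorial part `∏_ζ 𝓘_{cl ζ}^{a(ζ)}` (★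
`isLocallyPrincipal_iff_codimTwoPart_eq_top`, ★ `divisorialPart_mul_codimTwoPart`), the codimension-one points `ζ` of
`V(I) = cl{η}` lie below `η`, are pairwise incomparable (★ `not_specializes_of_coheight_eq_one`) and exist (else `I = 𝒪_X`), so
`{ζ} = {η}`.  Hartshorne II.6.11: on a locally factorial (e.g. regular, Auslander–Buchsbaum) integral scheme Cartier divisors are
the Weil divisors `∑ v_Y(D) · Y`. [cite: Hartshorne1977, II.6 Prop. 6.11 and Remark 6.11.2 (pp. 141–142)]
[cite: CossartPiltant2008, proof of Prop. 4.2] [cite: GortzWedhorn2020, Thm. 11.40 (2)] -/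
theorem IsEffectiveCartier.eq_primeDivisorIdeal_pow_of_support_eq_closure [IsIntegral X] [IsNoetherian X]
    (hX : Scheme.IsRegular X) {I : X.IdealSheafData} (hI : IsEffectiveCartier I) {η : X}
    (hη : (I.support : Set X) = closure {η}) :
    Order.coheight η = 1 ∧ 0 < (idealOrder I η).toNat ∧ I = primeDivisorIdeal η ^ (idealOrder I η).toNat := by
  classical
  haveI : Nonempty X := ⟨η⟩
  have hI0 : I ≠ ⊥ := hI.ne_bot_of_nonempty
  have hηsupp : η ∈ I.support := by
    change η ∈ (I.support : Set X)
    rw [hη]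
    exact subset_closure rfl
  -- every point of `V(I)` is a specialisation of `η`
  have hspec : ∀ {ζ : X}, ζ ∈ I.support → η ⤳ ζ := fun {ζ} hζ => by
    rw [specializes_iff_mem_closure, ← hη]
    exact hζ
  -- `I` is its divisorial part
  have hcod : codimTwoPart I = ⊤ := (isLocallyPrincipal_iff_codimTwoPart_eq_top hX hI0).mp hI.isLocallyPrincipal
  have hIH : I = divisorialPart I := by
    have h := divisorialPart_mul_codimTwoPart hX hI0
    rw [hcod, ← Scheme.IdealSheafData.one_eq_top, mul_one] at h
    exact h.symm
  have hfin := finite_divisorialPoints hI0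
  -- `η` is not the generic point, so `coheight η ≠ 0`
  have hη0 : Order.coheight η ≠ 0 := fun h0 =>
    not_mem_support_genericPoint hI0 (eq_genericPoint_of_coheight_eq_zero h0 ▸ hηsupp)
  -- there is a codimension-one point of `V(I)` (else `I = 𝒪_X`)
  have hne : hfin.toFinset.Nonempty := by
    by_contra hemp
    rw [Finset.not_nonempty_iff_eq_empty] at hemp
    have htop : I = ⊤ := by
      rw [hIH, divisorialPart_eq hfin, hemp, Finset.prod_empty, Scheme.IdealSheafData.one_eq_top]
    have h' : η ∈ ((⊤ : X.IdealSheafData).support : Set X) := by rw [← htop]; exact hηsupp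
    rw [Scheme.IdealSheafData.support_top, Closeds.coe_bot] at h'
    exact h'
  obtain ⟨ζ₀, hζ₀⟩ := hne
  have hζ₀' : ζ₀ ∈ divisorialPoints I := (Set.Finite.mem_toFinset _).mp hζ₀
  -- `coheight η ≤ coheight ζ₀ = 1`, hence `coheight η = 1`
  have hη1 : Order.coheight η = 1 := by
    have hle : Order.coheight η ≤ 1 := by
      rw [← hζ₀'.2]
      exact Order.coheight_anti (Scheme.le_iff_specializes.mpr (hspec hζ₀'.1))
    exact le_antisymm hle (Order.one_le_iff_ne_zero.mpr hη0)
  have hηdiv : η ∈ divisorialPoints I := ⟨hηsupp, hη1⟩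
  -- `η` is the only codimension-one point of `V(I)`
  have hsingle : hfin.toFinset = {η} := by
    refine Finset.eq_singleton_iff_unique_mem.mpr ⟨(Set.Finite.mem_toFinset _).mpr hηdiv, fun ζ hζ => ?_⟩
    have hζ' : ζ ∈ divisorialPoints I := (Set.Finite.mem_toFinset _).mp hζ
    by_contra hne
    exact not_specializes_of_coheight_eq_one hη1 hζ'.2 (Ne.symm hne) (hspec hζ'.1)
  -- the exponent is positive: `I_η = 𝔪_η^a ⊆ 𝔪_η`
  have ha : 0 < (idealOrder I η).toNat := by
    rw [Nat.pos_iff_ne_zero]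
    intro ha0
    have h1 := stalkIdeal_eq_pow_of_mem_divisorialPoints hX hI0 hηdiv
    rw [ha0, pow_zero, Ideal.one_eq_top] at h1
    have h2 := (mem_support_iff_stalkIdeal_le I η).mp hηsupp
    rw [h1, top_le_iff] at h2
    exact (maximalIdeal.isMaximal (X.presheaf.stalk η)).ne_top h2
  refine ⟨hη1, ha, ?_⟩
  conv_lhs => rw [hIH, divisorialPart_eq hfin, hsingle, Finset.prod_singleton]

end Literature.AlgebraicGeometry.Resolution

namespace Literature.AlgebraicGeometry.Motives

namespace CartierDivisor

open RatFn Literature.AlgebraicGeometry.Resolution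

variable {X : Scheme.{u}} [IsIntegral X]

/-! ## §3 Effective Cartier divisors with irreducible support -/

/-- **An effective Cartier divisor whose support is irreducible is a positive multiple of the prime divisor of its support**
(regular integral Noetherian `X`): if `D ≥ 0` and `X ∖ X_1 = cl{η}`, then `η` has codimension one and `D` is the same divisor as
`a • [cl η]` for some `a ≥ 1`, where `[cl η]` is the effective Cartier divisor of the prime divisor ideal `𝓘_{cl η}` (★
`ofIsEffectiveCartier`, ★ `isEffectiveCartier_primeDivisorIdeal_of_isRegular`).  From §2 through `𝒪(−D)` (★ `IsEffective.idealSheaf`,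
§1). Hartshorne II.6.11 (`CaCl = Cl` on locally factorial schemes, one prime divisor). [cite: Hartshorne1977, II.6 Prop. 6.11 and Remark 6.11.2 (pp. 141–142)]
[cite: GortzWedhorn2020, Thm. 11.40 (2)] -/
theorem IsEffective.exists_sameDivisor_smul_of_support_eq_closure [IsNoetherian X] (hX : Scheme.IsRegular X)
    {D : CartierDivisor X} (hD : D.IsEffective) {η : X} (hη : (D.nonvanishing 1)ᶜ = closure {η}) :
    ∃ (h1 : Order.coheight η = 1) (a : ℕ), 0 < a ∧
      D.SameDivisor (a • ofIsEffectiveCartier (primeDivisorIdeal η) (isEffectiveCartier_primeDivisorIdeal_of_isRegular hX h1)) := by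
  have hsupp : (hD.idealSheaf.support : Set X) = closure {η} := by rw [hD.coe_support_idealSheaf, hη]
  obtain ⟨h1, ha, hI⟩ := hD.isEffectiveCartier_idealSheaf.eq_primeDivisorIdeal_pow_of_support_eq_closure hX hsupp
  refine ⟨h1, (idealOrder hD.idealSheaf η).toNat, ha, ?_⟩
  have hP := isEffectiveCartier_primeDivisorIdeal_of_isRegular hX h1
  have hPeff := isEffective_ofIsEffectiveCartier (primeDivisorIdeal η) hP
  refine SameDivisor.of_idealSheaf_eq hD (hPeff.smul _) ?_
  rw [hPeff.idealSheaf_smul, idealSheaf_ofIsEffectiveCartier]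
  exact hI

/-- **Two effective Cartier divisors with the same irreducible support are multiples of one divisor** (regular integral
Noetherian `X`): `E₁ = m₁ • [Z]`, `E₂ = m₂ • [Z]` with `m₁, m₂ ≥ 1`, `Z = X ∖ X_1` the common support (its generic point has
codimension one). [cite: Hartshorne1977, II.6 Prop. 6.11 and Remark 6.11.2 (pp. 141–142)] [cite: GortzWedhorn2020, Thm. 11.40 (2)] -/
theorem exists_sameDivisor_smul_of_support_eq [IsNoetherian X] (hX : Scheme.IsRegular X) (E₁ E₂ : CartierDivisor X)
    (h₁ : E₁.IsEffective) (h₂ : E₂.IsEffective) (hsupp : (E₁.nonvanishing 1)ᶜ = (E₂.nonvanishing 1)ᶜ)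
    (hirr : IsIrreducible (E₁.nonvanishing 1)ᶜ) :
    ∃ (D : CartierDivisor X) (m₁ m₂ : ℕ), 0 < m₁ ∧ 0 < m₂ ∧ E₁.SameDivisor (m₁ • D) ∧ E₂.SameDivisor (m₂ • D) := by
  have hcl : IsClosed (E₁.nonvanishing 1)ᶜ := (E₁.isOpen_nonvanishing 1).isClosed_compl
  have hη : (E₁.nonvanishing 1)ᶜ = closure {hirr.genericPoint} := (hirr.closure_genericPoint hcl).symm
  obtain ⟨h1, m₁, hm₁, hE₁⟩ := h₁.exists_sameDivisor_smul_of_support_eq_closure hX hη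
  obtain ⟨h1', m₂, hm₂, hE₂⟩ := h₂.exists_sameDivisor_smul_of_support_eq_closure hX (hsupp.symm.trans hη)
  exact ⟨_, m₁, m₂, hm₁, hm₂, hE₁, hE₂⟩

end CartierDivisor

namespace AbelianVariety

/-! ## §4 The case of an abelian variety over a field (letter (ii) of the (Θ-uniq) chain) -/

/-- **On an abelian variety over a field, two effective Cartier divisors with the same irreducible support are positive
multiples of one divisor**: `E₁ = m₁ • D`, `E₂ = m₂ • D` (same divisor), `m₁, m₂ ≥ 1`.  The underlying scheme is regular (smooth
over a field, ★ `AbelianVariety.isRegularLocalRing_stalk`), integral and Noetherian (★ `isNoetherian_left`); apply §3.  The use: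
two theta divisors with support the same translate of the IRREDUCIBLE `W̃_{g−1}` (Lange Lemma 4.2.1 (ii), Cor. 4.2.4).
[cite: Hartshorne1977, II.6 Prop. 6.11 and Remark 6.11.2 (pp. 141–142)] [cite: Lange2023AbelianVarietiesComplex, §4.2.1 Lemma 4.2.1 and Cor. 4.2.4] -/
theorem exists_sameDivisor_smul_of_support_eq {k : Type u} [Field k] (A : AbelianVariety k)
    (E₁ E₂ : CartierDivisor A.X.left) (h₁ : E₁.IsEffective) (h₂ : E₂.IsEffective)
    (hsupp : (E₁.nonvanishing 1)ᶜ = (E₂.nonvanishing 1)ᶜ) (hirr : IsIrreducible (E₁.nonvanishing 1)ᶜ) :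
    ∃ (D : CartierDivisor A.X.left) (m₁ m₂ : ℕ), 0 < m₁ ∧ 0 < m₂ ∧ E₁.SameDivisor (m₁ • D) ∧ E₂.SameDivisor (m₂ • D) := by
  haveI := A.isNoetherian_left
  exact CartierDivisor.exists_sameDivisor_smul_of_support_eq (fun x => A.isRegularLocalRing_stalk x) E₁ E₂ h₁ h₂ hsupp hirr

end AbelianVariety

end Literature.AlgebraicGeometry.Motives

end
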